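import Summits.CriticalPhenomena.CardyFormulaZ2.Theorems.RectilinearCardy.Negative.RectilinearCardyLShape
import Summits.CriticalPhenomena.CardyFormulaZ2.Theorems.ModulusResponseSquarePinning
import Literature.Probability.Percolation.CardyFormula

/-!
# The diagonal-symmetric L-quad is crossed with probability `→ 1/2` (stub `stub_lShapeHalf`)

Sub-goal (C) of the `SimilarityUpgrade` crux (lead c4). Let `Ω = (0,2)² ∖ [1,2]²` be the L-shape
and `R = lShapeQuad = (Ω; 0, 2, 1+i, 2i)` the tree's L-shaped conformal rectangle
(`RectilinearCardyLShape.lean`). If the G02 discretisation of bond percolation on `ℤ²` at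
`p = 1/2` is *limit self-dual* — for every conformal rectangle,
`P[C_δ(arc 0 ↔ arc 2)] + P[C_δ(arc 1 ↔ arc 3)] → 1` as `δ → 0⁺` — then
`bondDomainCrossingProb lShapeQuad δ → 1/2`.

Proof sketch. The four arcs of `R` are computed from the boundary hexagon
(`lShapeQuad_arc_zero` … `lShapeQuad_arc_three`): `arc 0 = [0, 2]` (bottom side),
`arc 1 = [2, 2+i] ∪ [2+i, 1+i]`, `arc 2 = [1+i, 1+2i] ∪ [1+2i, 2i]`, `arc 3 = [2i, 0]` (left side).
The anti-linear LATTICE symmetry `σ z = i z̄` (reflection in the diagonal; `σ = swapH`, the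
composite of the cell symmetries `CellSymmetry.reflect` then `CellSymmetry.rot`) preserves `Ω`
(`swapH_image_carrier`) and exchanges the two arc pairs: `σ(arc 0) = arc 3`, `σ(arc 2) = arc 1`.
Since every cell symmetry of `ℤ²` is an exact symmetry of G02's crossing probability at every mesh
(`ModulusResponseSquarePinning.discreteCrossingProb_image_plane`) and the crossing event is
symmetric in its two arcs, `P[C_δ(arc 1 ↔ arc 3)] = P[C_δ(arc 0 ↔ arc 2)] = bondDomainCrossingProb R δ`
for every `δ`; so the dual sum at `R` reads `2 · bondDomainCrossingProb R δ → 1`.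

Bonus (`cardy_lShapeQuad_of_dualSum`): since the modulus of the L-quad is `1/2`
(`crossRatio_lShapeQuad`) and `F(1/2) = 1/2` (`cardyFunction_half`), this is Cardy's formula for
the L-quad, conditionally on limit self-duality.

References: S. Smirnov, *Critical percolation in the plane*, C. R. Acad. Sci. Paris 333 (2001),
§2; G. R. Grimmett, *Percolation* (1999), §9.7 and Lemma 11.21 (self-duality at `p = 1/2`);
J. Cardy, J. Phys. A 25 (1992) L201.
-/

noncomputable section

namespace Summit.CriticalPhenomena.CardyFormulaZ2.Cruxes.SimilarityUpgrade.Stubs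

open Filter Topology Set MeasureTheory
open Literature.Probability.RandomPlanarGeometry
open Literature.Probability.Percolation
open scoped ComplexConjugate
open Complex (I)
open Literature.Probability.LatticeModels (CellSymmetry)
open Summit.CriticalPhenomena.CardyFormulaZ2.Theorems.RectilinearCardy.Negative
open Summit.CriticalPhenomena.CardyFormulaZ2.Theorems.ModulusResponseSquarePinning
  (discreteCrossingProb_image_plane)

/-! ### The four arcs of the L-quad -/

/-- Side number `k` of the hexagon: the boundary loop of the L-quad maps `[k/6, (k+1)/6]` onto the
closed segment from vertex `k` to vertex `k + 1 (mod 6)`. [folklore] -/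
theorem lShapeQuad_boundary_image_Icc {k : ℕ} (hk : k < lVerts.length) (a b : ℝ)
    (ha : a = k / 6) (hb : b = (k + 1) / 6) :
    lShapeQuad.boundary '' Icc a b =
      segment ℝ lVerts[k] (lVerts[(k + 1) % lVerts.length]'(Nat.mod_lt _ (by simp))) := by
  subst ha hb
  have h := image_polygonLoop_Icc_div (l := lVerts) hk
  rw [show ((lVerts.length : ℕ) : ℝ) = 6 by simp] at h
  rw [lShapeQuad_boundary]
  exact h

/-- The marks of the L-quad are `0, 1/6, 3/6, 5/6`. [folklore] -/
theorem lShapeQuad_mark : lShapeQuad.mark = ![0, 1 / 6, 3 / 6, 5 / 6] := rfl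

/-- Arc `0` of the L-quad is its bottom side `[0, 2]`. [folklore] -/
theorem lShapeQuad_arc_zero : lShapeQuad.arc 0 = segment ℝ (0 : ℂ) 2 := by
  rw [MarkedDomain.arc, MarkedDomain.nextMark_of_lt _ 0 (by decide)]
  have hm : lShapeQuad.mark 0 = 0 := rfl
  have hm' : lShapeQuad.mark ⟨(0 : Fin 4).val + 1, by decide⟩ = 1 / 6 := rfl
  rw [hm, hm', lShapeQuad_boundary_image_Icc (k := 0) (by simp) 0 (1 / 6) (by norm_num) (by norm_num)]
  rfl

/-- Arc `1` of the L-quad: the right side `[2, 2+i]` followed by the lower edge `[2+i, 1+i]` of the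
notch. [folklore] -/
theorem lShapeQuad_arc_one :
    lShapeQuad.arc 1 = segment ℝ (2 : ℂ) (2 + I) ∪ segment ℝ (2 + I) (1 + I) := by
  rw [MarkedDomain.arc, MarkedDomain.nextMark_of_lt _ 1 (by decide)]
  have hm : lShapeQuad.mark 1 = 1 / 6 := rfl
  have hm' : lShapeQuad.mark ⟨(1 : Fin 4).val + 1, by decide⟩ = 3 / 6 := rfl
  rw [hm, hm', ← Icc_union_Icc_eq_Icc (b := 2 / 6) (by norm_num) (by norm_num), image_union,
    lShapeQuad_boundary_image_Icc (k := 1) (by simp) (1 / 6) (2 / 6) (by norm_num) (by norm_num),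
    lShapeQuad_boundary_image_Icc (k := 2) (by simp) (2 / 6) (3 / 6) (by norm_num) (by norm_num)]
  rfl

/-- Arc `2` of the L-quad: the right edge `[1+i, 1+2i]` of the notch followed by the top side
`[1+2i, 2i]`. [folklore] -/
theorem lShapeQuad_arc_two :
    lShapeQuad.arc 2 = segment ℝ (1 + I) (1 + 2 * I) ∪ segment ℝ (1 + 2 * I) (2 * I) := by
  rw [MarkedDomain.arc, MarkedDomain.nextMark_of_lt _ 2 (by decide)]
  have hm : lShapeQuad.mark 2 = 3 / 6 := rfl
  have hm' : lShapeQuad.mark ⟨(2 : Fin 4).val + 1, by decide⟩ = 5 / 6 := rfl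
  rw [hm, hm', ← Icc_union_Icc_eq_Icc (b := 4 / 6) (by norm_num) (by norm_num), image_union,
    lShapeQuad_boundary_image_Icc (k := 3) (by simp) (3 / 6) (4 / 6) (by norm_num) (by norm_num),
    lShapeQuad_boundary_image_Icc (k := 4) (by simp) (4 / 6) (5 / 6) (by norm_num) (by norm_num)]
  rfl

/-- Arc `3` of the L-quad is its left side `[2i, 0]`. [folklore] -/
theorem lShapeQuad_arc_three : lShapeQuad.arc 3 = segment ℝ (2 * I) 0 := by
  rw [MarkedDomain.arc, MarkedDomain.nextMark_of_not_lt _ 3 (by decide)]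
  have hm : lShapeQuad.mark 3 = 5 / 6 := rfl
  have hm' : lShapeQuad.mark 0 = 0 := rfl
  rw [hm, hm', lShapeQuad_boundary_image_Icc (k := 5) (by simp) (5 / 6) (0 + 1) (by norm_num)
    (by norm_num)]
  rfl

/-! ### The diagonal symmetry exchanges the arc pairs -/

/-- The reflection `σ z = i z̄` maps the bottom side onto the left side: `σ(arc 0) = arc 3`.
[folklore] -/
theorem swapH_image_arc_zero : swapH '' lShapeQuad.arc 0 = lShapeQuad.arc 3 := by
  have hcoe : (swapH : ℂ → ℂ) = swapL := rfl
  rw [lShapeQuad_arc_zero, lShapeQuad_arc_three, hcoe, swapL_image_segment]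
  have e0 : swapL 0 = 0 := by apply Complex.ext <;> simp
  have e1 : swapL 2 = 2 * I := by apply Complex.ext <;> simp
  rw [e0, e1, segment_symm]

/-- The reflection `σ z = i z̄` maps arc `2` (around the notch, upper-left) onto arc `1` (around the
notch, lower-right): `σ(arc 2) = arc 1`. [folklore] -/
theorem swapH_image_arc_two : swapH '' lShapeQuad.arc 2 = lShapeQuad.arc 1 := by
  have hcoe : (swapH : ℂ → ℂ) = swapL := rfl
  rw [lShapeQuad_arc_two, lShapeQuad_arc_one, hcoe, image_union, swapL_image_segment,
    swapL_image_segment]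
  have e3 : swapL (1 + I) = 1 + I := by apply Complex.ext <;> simp
  have e4 : swapL (1 + 2 * I) = 2 + I := by apply Complex.ext <;> simp
  have e5 : swapL (2 * I) = 2 := by apply Complex.ext <;> simp
  rw [e3, e4, e5, union_comm, segment_symm ℝ (2 + I) 2, segment_symm ℝ (1 + I) (2 + I)]

/-! ### Lattice symmetry of the crossing probability -/

/-- The reflection `σ z = i z̄` is the composite of the two generating cell symmetries of `ℤ²`:
complex conjugation followed by the quarter turn. [folklore] -/
theorem image_swapH_eq (X : Set ℂ) :
    swapH '' X = CellSymmetry.rot.plane '' (CellSymmetry.reflect.plane '' X) := by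
  rw [Set.image_image]
  refine image_congr fun z _ => ?_
  simp

/-- **`σ z = i z̄` is an exact symmetry of G02's bond crossing probability**, mesh by mesh
(two applications of `discreteCrossingProb_image_plane`). [folklore] -/
theorem discreteCrossingProb_image_swapH (p : unitInterval) (Ω : Set ℂ) (δ : ℝ) (A B : Set ℂ) :
    discreteCrossingProb p (swapH '' Ω) δ (swapH '' A) (swapH '' B) =
      discreteCrossingProb p Ω δ A B := by
  rw [image_swapH_eq, image_swapH_eq, image_swapH_eq, discreteCrossingProb_image_plane,
    discreteCrossingProb_image_plane]

/-- The crossing probability is symmetric in its two arcs (open paths reverse). [folklore] -/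
private theorem discreteCrossingProb_comm_lShape (p : unitInterval) (Ω : Set ℂ) (δ : ℝ)
    (A B : Set ℂ) : discreteCrossingProb p Ω δ A B = discreteCrossingProb p Ω δ B A := by
  have h : discreteCrossing Ω δ A B = discreteCrossing Ω δ B A := by
    ext ω
    simp only [mem_discreteCrossing_iff]
    constructor
    · rintro ⟨x, hx, y, hy, hxy⟩
      exact ⟨y, hy, x, hx, hxy.symm⟩
    · rintro ⟨x, hx, y, hy, hxy⟩
      exact ⟨y, hy, x, hx, hxy.symm⟩
  unfold discreteCrossingProb
  rw [h]

/-- **The dual crossing probability of the L-quad equals its crossing probability**, at every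
mesh: `P[C_δ(Ω; arc 1, arc 3)] = P[C_δ(Ω; arc 3, arc 1)] = P[C_δ(σΩ; σ arc 0, σ arc 2)]
= P[C_δ(Ω; arc 0, arc 2)]`. [folklore] -/
theorem discreteCrossingProb_lShapeQuad_dual_eq (δ : ℝ) :
    discreteCrossingProb half lShapeQuad.carrier δ (lShapeQuad.arc 1) (lShapeQuad.arc 3) =
      bondDomainCrossingProb lShapeQuad δ := by
  calc discreteCrossingProb half lShapeQuad.carrier δ (lShapeQuad.arc 1) (lShapeQuad.arc 3)
      = discreteCrossingProb half lShapeQuad.carrier δ (lShapeQuad.arc 3) (lShapeQuad.arc 1) :=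
        discreteCrossingProb_comm_lShape _ _ _ _ _
    _ = discreteCrossingProb half (swapH '' lShapeQuad.carrier) δ (swapH '' lShapeQuad.arc 0)
          (swapH '' lShapeQuad.arc 2) := by
        rw [swapH_image_carrier, swapH_image_arc_zero, swapH_image_arc_two]
    _ = bondDomainCrossingProb lShapeQuad δ := discreteCrossingProb_image_swapH _ _ _ _ _

/-! ### The stub -/

/-- **The diagonal-symmetric L-quad is crossed with probability `→ 1/2`**, given limit
self-duality of the G02 discretisation: at `R = lShapeQuad` the dual sum is
`2 · bondDomainCrossingProb lShapeQuad δ → 1`. [folklore] -/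
theorem stub_lShapeHalf :
    (∀ R : ConformalRectangle, Tendsto (fun δ : ℝ => bondDomainCrossingProb R δ +
      discreteCrossingProb half R.carrier δ (R.arc 1) (R.arc 3)) (𝓝[>] (0 : ℝ)) (𝓝 1)) →
    Tendsto (bondDomainCrossingProb Summit.CriticalPhenomena.CardyFormulaZ2.Theorems.RectilinearCardy.Negative.lShapeQuad) (𝓝[>] (0 : ℝ)) (𝓝 (1 / 2)) := by
  intro hDual
  have h2 : Tendsto (fun δ : ℝ => bondDomainCrossingProb lShapeQuad δ +
      bondDomainCrossingProb lShapeQuad δ) (𝓝[>] (0 : ℝ)) (𝓝 1) :=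
    (hDual lShapeQuad).congr fun δ => by rw [discreteCrossingProb_lShapeQuad_dual_eq]
  refine (h2.div_const 2).congr fun δ => ?_
  ring

/-- **Cardy's formula for the L-quad, given limit self-duality**: the modulus of
`((0,2)² ∖ [1,2]²; 0, 2, 1+i, 2i)` is `1/2` (`crossRatio_lShapeQuad`) and `F(1/2) = 1/2`
(`cardyFunction_half`). [folklore] -/
theorem cardy_lShapeQuad_of_dualSum :
    (∀ R : ConformalRectangle, Tendsto (fun δ : ℝ => bondDomainCrossingProb R δ +
      discreteCrossingProb half R.carrier δ (R.arc 1) (R.arc 3)) (𝓝[>] (0 : ℝ)) (𝓝 1)) →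
    Summit.CriticalPhenomena.CardyFormulaZ2.Theorems.RectilinearCardy.Negative.lShapeQuad.HasCrossingLimit
      (bondDomainCrossingProb Summit.CriticalPhenomena.CardyFormulaZ2.Theorems.RectilinearCardy.Negative.lShapeQuad)
      Literature.Probability.RandomPlanarGeometry.cardyFunction := by
  intro hDual φ x hφx
  rw [crossRatio_lShapeQuad hφx, cardyFunction_half]
  exact stub_lShapeHalf hDual

end Summit.CriticalPhenomena.CardyFormulaZ2.Cruxes.SimilarityUpgrade.Stubs

end
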